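import Mathlib.Analysis.SpecialFunctions.Pow.Real
import HarnessLib

/-!
# FarEdgeDescent — kernel XXXIX-L: linear towers pass every node floor (model level, def-free)

Helper kernel for `FarEdgeDescent.FiniteSaturation` (decomp-mm lens 2 «special vs generic», generation 59).
Companion of XXXIX-J (`FarEdgeDescentDialLinearTower`: linear towers do not amplify the deviation) and of
XXXIX-H/I/K (squaring towers below `β = 2` violate a Landsberg–Ottaviani node floor at finite depth).  Here:
the LINEAR tower `O_{k+1} = O_k ⊗ B` of the β-dial, grown from an anchored base `B = ⟨1,Q_B,1⟩ ⊕ (legs of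
width a, mass L_B)`, PASSES every node floor «(2 − a^{−j})·(leg mass of width ≥ a^j) ≤ β·L» (XXXIX-G
`anchored_lo_floor_wide` with `p + 1 = a^j`, read through the dial's dictionary) at every node and every depth,
provided the base floor holds (`2 − 1/a ≤ β`, XXXIX-F) and the anchor ratios start on the heavy side of the
fixed point (`(β−1)·L_B ≤ Q_B`, `(β−1)·L₀ ≤ Q₀`; the tower's ratio `Q_k/L_k` then stays `≥ β − 1`).

Primitive bookkeeping of one linear step (anchor×legs(B) are fresh width-`a` legs of mass `Q·L_B`;
legs×anchor(B) keep their width; legs×legs(B) gain one factor `a`):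
  `S_j'' = Q_B·S_j + L_B·S_{j−1}` for `j ≥ 2` (`S_j` = leg mass of width `≥ a^j`, `S_1 = L`),
  `L'' = Q_B·L + L_B·L + Q·L_B`,  `Q'' = Q·Q_B + β(β−1)·L·L_B`.
The invariant is `β^{j−1}·S_j ≤ L` (the stationary width distribution is geometric with ratio `1/β`), and the
floor follows from `2 − a^{−j} ≤ β^j` (`a ≥ 2`, `β ≥ 2 − 1/a`).

So, at model level, the three pure schedules are settled: squaring towers are floor-inconsistent for every
`β < 2` (H/I/K), linear towers are floor-consistent (this file) but inert (J); only mixed schedules remain.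
MODEL-LEVEL (sequences of reals).  Route `FarEdgeDescent`, cut `closes (h₁ : FiniteSaturation)
(h₂ : AnchoredLogConvexity)` unchanged; supports h₁ (stmt-MatrixMultiplication-23739) as a helper, decides nothing.
-/

set_option linter.dupNamespace false

namespace Summit.MatrixMultiplication.MatrixMultiplication.Theorems.FarEdgeDescentDialLinearTowerFloors

/-- The numerical inequality behind the floors of a linear tower: `2 − a^{−j} ≤ β^j` for `j ≥ 1`, `a ≥ 2`,
`β ≥ 2 − 1/a` (for `j = 1` it is the base floor; for `j ≥ 2`, `β^j ≥ β² ≥ (2 − 1/a)² ≥ 2`). -/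
theorem two_sub_inv_pow_le_pow {a β : ℝ} (ha : 2 ≤ a) (hβa : 2 - 1 / a ≤ β) (j : ℕ) (hj : 1 ≤ j) :
    2 - 1 / a ^ j ≤ β ^ j := by
  have ha0 : 0 < a := by linarith
  have ht : 1 / a ≤ 1 / 2 := by
    rw [div_le_div_iff₀ ha0 (by norm_num : (0:ℝ) < 2)]; linarith
  have ht0 : 0 < 1 / a := by positivity
  have hβ1 : 1 ≤ β := by linarith
  rcases Nat.lt_or_ge j 2 with hj2 | hj2
  · obtain rfl : j = 1 := by omega
    simpa using hβa
  · have hsq : 2 ≤ β ^ 2 := by nlinarith [mul_le_mul ht ht ht0.le (by norm_num : (0:ℝ) ≤ 1 / 2)]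
    have hpow : β ^ 2 ≤ β ^ j := pow_le_pow_right₀ hβ1 hj2
    have hinv : 0 < 1 / a ^ j := by positivity
    linarith

/-- THE INVARIANT.  Along a linear tower with anchor ratios on the heavy side of the fixed point, the leg mass of
width `≥ a^j` is at most `β^{1−j}` of the total: `β^{j−1}·S_j(k) ≤ L_k` (stated with `j = i + 1`). -/
theorem linear_tower_geometric {β QB LB : ℝ} (hβ1 : 1 ≤ β) (hQB : 0 ≤ QB) (hLB : 0 ≤ LB)
    (hρB : (β - 1) * LB ≤ QB) (Q L : ℕ → ℝ) (S : ℕ → ℕ → ℝ) (hL0 : 0 ≤ L 0)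
    (hρ0 : (β - 1) * L 0 ≤ Q 0) (hS1 : ∀ k, S 1 k = L k) (hS0 : ∀ j k, 0 ≤ S j k)
    (hSinit : ∀ j, S (j + 2) 0 = 0)
    (hS : ∀ j k, S (j + 2) (k + 1) = QB * S (j + 2) k + LB * S (j + 1) k)
    (hL : ∀ k, L (k + 1) = QB * L k + LB * L k + Q k * LB)
    (hQ : ∀ k, Q (k + 1) = Q k * QB + β * (β - 1) * L k * LB) :
    ∀ k i, β ^ i * S (i + 1) k ≤ L k := by
  -- nonnegativity of L and the ratio invariant (β−1)L ≤ Q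
  have hLnn : ∀ k, 0 ≤ L k := fun k => by rw [← hS1]; exact hS0 1 k
  have hρ : ∀ k, (β - 1) * L k ≤ Q k := by
    intro k
    induction k with
    | zero => exact hρ0
    | succ k ih =>
      rw [hQ, hL]
      have hkey : 0 ≤ (Q k - (β - 1) * L k) * (QB - (β - 1) * LB) :=
        mul_nonneg (by linarith) (by linarith)
      nlinarith [hkey]
  intro k
  induction k with
  | zero =>
    intro i
    cases i with
    | zero => simp [hS1]
    | succ i => rw [hSinit]; simp [hL0]
  | succ k ih =>
    intro i
    cases i with
    | zero => simp [hS1]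
    | succ i =>
      rw [hS, hL, pow_succ]
      have h1 : β ^ (i + 1) * S (i + 2) k ≤ L k := ih (i + 1)
      have h2 : β ^ i * S (i + 1) k ≤ L k := ih i
      have hβ0 : 0 ≤ β := by linarith
      have hpow0 : 0 ≤ β ^ i := pow_nonneg hβ0 i
      -- β^{i+1}·(QB·S_{i+2} + LB·S_{i+1}) ≤ QB·L + β·LB·L ≤ QB·L + LB·L + Q·LB
      have e1 : β ^ i * β * (QB * S (i + 2) k) = QB * (β ^ (i + 1) * S (i + 2) k) := by ring
      have e2 : β ^ i * β * (LB * S (i + 1) k) = β * LB * (β ^ i * S (i + 1) k) := by ring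
      rw [mul_add, e1, e2]
      have h3 : QB * (β ^ (i + 1) * S (i + 2) k) ≤ QB * L k := mul_le_mul_of_nonneg_left h1 hQB
      have h4 : β * LB * (β ^ i * S (i + 1) k) ≤ β * LB * L k :=
        mul_le_mul_of_nonneg_left h2 (mul_nonneg hβ0 hLB)
      nlinarith [mul_le_mul_of_nonneg_right (hρ k) hLB]

/-- LINEAR TOWERS PASS EVERY NODE FLOOR.  For `a ≥ 2`, `2 − 1/a ≤ β` (the base floor) and anchor ratios on the
heavy side of the fixed point, every node `k` of the linear tower and every depth `j ≥ 1` satisfy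
`(2 − a^{−j})·S_j(k) ≤ β·L_k` — the Landsberg–Ottaviani node floor of XXXIX-G in the dial's dictionary. -/
theorem linear_tower_passes_floors {a β QB LB : ℝ} (ha : 2 ≤ a) (hβa : 2 - 1 / a ≤ β) (hQB : 0 ≤ QB)
    (hLB : 0 ≤ LB) (hρB : (β - 1) * LB ≤ QB) (Q L : ℕ → ℝ) (S : ℕ → ℕ → ℝ) (hL0 : 0 ≤ L 0)
    (hρ0 : (β - 1) * L 0 ≤ Q 0) (hS1 : ∀ k, S 1 k = L k) (hS0 : ∀ j k, 0 ≤ S j k)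
    (hSinit : ∀ j, S (j + 2) 0 = 0)
    (hS : ∀ j k, S (j + 2) (k + 1) = QB * S (j + 2) k + LB * S (j + 1) k)
    (hL : ∀ k, L (k + 1) = QB * L k + LB * L k + Q k * LB)
    (hQ : ∀ k, Q (k + 1) = Q k * QB + β * (β - 1) * L k * LB) :
    ∀ k j, 1 ≤ j → (2 - 1 / a ^ j) * S j k ≤ β * L k := by
  have ha0 : 0 < a := by linarith
  have hia : 1 / a ≤ 1 / 2 := by
    rw [div_le_div_iff₀ ha0 (by norm_num : (0:ℝ) < 2)]; linarith
  have hβ1 : 1 ≤ β := by linarith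
  have hgeo := linear_tower_geometric hβ1 hQB hLB hρB Q L S hL0 hρ0 hS1 hS0 hSinit hS hL hQ
  intro k j hj
  obtain ⟨i, rfl⟩ : ∃ i, j = i + 1 := ⟨j - 1, by omega⟩
  have hnum := two_sub_inv_pow_le_pow ha hβa (i + 1) hj
  have hinv0 : 0 ≤ 2 - 1 / a ^ (i + 1) := by
    have : 1 / a ^ (i + 1) ≤ 1 := by
      rw [div_le_one (by positivity)]; exact one_le_pow₀ (by linarith)
    linarith
  have hpos : 0 < β ^ i := pow_pos (by linarith) i
  have hLnn : 0 ≤ L k := by rw [← hS1]; exact hS0 1 k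
  -- multiply the target by β^i and use β^i·S_{i+1} ≤ L, (2 − a^{−(i+1)}) ≤ β^{i+1}
  refine le_of_mul_le_mul_left ?_ hpos
  calc β ^ i * ((2 - 1 / a ^ (i + 1)) * S (i + 1) k)
      = (2 - 1 / a ^ (i + 1)) * (β ^ i * S (i + 1) k) := by ring
    _ ≤ β ^ (i + 1) * L k := mul_le_mul hnum (hgeo k i) (mul_nonneg hpos.le (hS0 _ _)) (by positivity)
    _ = β ^ i * (β * L k) := by ring

end Summit.MatrixMultiplication.MatrixMultiplication.Theorems.FarEdgeDescentDialLinearTowerFloors
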